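import Summits.CriticalPhenomena.CardyFormulaZ2.Theorems.HalfPlaneMarkDensityLaw.Negative.MarkEvents
import Literature.Probability.Percolation.LatticeSymmetry

/-!
# `HalfPlaneMarkDensityLaw` (crux stmt-CriticalPhenomena-5661), line `Sketch`, Positivity Q2:
# stub `stub_nearestLeft_shift` — translation invariance of the nearest-left event

For `k ∈ ℤ` let `NL(k; lo, hi)` be the event that `(k,0)` is joined inside the lattice half-plane
`H = ℤ × ℕ` to some `(t,0)` with `lo ≤ t ≤ hi` and to no `(s,0)` with `t < s < k` ("the nearest-left
bottom point of the `H`-cluster of `(k,0)` lies in `[lo, hi]`"). The events `NL(k; lo + k, hi + k)`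
and `NL(0; lo, hi)` are horizontal translates of one another: the relabelling `ω ↦ ω + (k,0)` of
bond configurations (`BondConfig.relabel (sym2Equiv (Site.shift (k,0)))`,
`BondPercolationSymmetry.lean`) pulls `NL(k; lo + k, hi + k)` back to `NL(0; lo, hi)`
(`relabel_mem_openConnIn` of `LatticeSymmetry.lean` in both directions, the half-plane being
invariant under horizontal shifts), and `P_{1/2}` on `ℤ²` is translation invariant
(`bondPercolation_real_preimage_shift`). Hence the two events are equiprobable.
-/

noncomputable section

namespace Summit.CriticalPhenomena.CardyFormulaZ2.Cruxes.HalfPlaneMarkDensityLaw.SketchLine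

open Literature.Probability.Percolation Literature.Probability.LatticeModels
open MeasureTheory Filter Set SimpleGraph
open scoped Topology
open Summit.CriticalPhenomena.CardyFormulaZ2.Theorems.HalfPlaneMarkDensityLaw.Negative

namespace Positivity

/-- `(i,0) + (k,0) = (i+k,0)`. [folklore] -/
theorem nlShift_bpt_add_bpt (i k : ℤ) : bpt i + bpt k = bpt (i + k) := by
  ext j; fin_cases j <;> simp [bpt]

/-- `(i,0) - (k,0) = (i-k,0)`. [folklore] -/
theorem nlShift_bpt_sub_bpt (i k : ℤ) : bpt i - bpt k = bpt (i - k) := by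
  ext j; fin_cases j <;> simp [bpt]

/-- The lattice half-plane is invariant under the horizontal shift by `(k,0)`. [folklore] -/
theorem nlShift_image_shift_halfPlane (k : ℤ) :
    (Site.shift (bpt k)) '' halfPlane = halfPlane := by
  rw [Equiv.image_eq_preimage_symm]
  ext v
  simp [halfPlane, bpt]

/-- The lattice half-plane is invariant under the inverse horizontal shift by `(k,0)`. [folklore] -/
theorem nlShift_image_shift_symm_halfPlane (k : ℤ) :
    (Site.shift (bpt k)).symm '' halfPlane = halfPlane := by
  rw [Equiv.image_symm_eq_preimage]
  ext v
  simp [halfPlane, bpt]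

/-- Transport of half-plane connections between bottom points along the shift by `(k,0)`:
`ω + (k,0) ∈ {(k,0) ↔ (j,0) in H} ↔ ω ∈ {(0,0) ↔ (j-k,0) in H}`. [folklore] -/
theorem nlShift_relabel_mem_openConnIn_iff (k j : ℤ) (ω : BondConfig (Site 2)) :
    BondConfig.relabel (sym2Equiv (Site.shift (bpt k))) ω ∈ openConnIn halfPlane (bpt k) (bpt j) ↔
      ω ∈ openConnIn halfPlane (bpt 0) (bpt (j - k)) := by
  constructor
  · intro h
    have h' := relabel_mem_openConnIn (Site.shift (bpt k)).symm h
    rw [relabel_symm_relabel, nlShift_image_shift_symm_halfPlane, Site.shift_symm_apply,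
      Site.shift_symm_apply, nlShift_bpt_sub_bpt, nlShift_bpt_sub_bpt, sub_self] at h'
    exact h'
  · intro h
    have h' := relabel_mem_openConnIn (Site.shift (bpt k)) h
    rw [nlShift_image_shift_halfPlane, Site.shift_apply, Site.shift_apply, nlShift_bpt_add_bpt,
      nlShift_bpt_add_bpt, zero_add, sub_add_cancel] at h'
    exact h'

/-- The shift by `(k,0)` pulls the nearest-left event at `(k,0)` with window `[lo+k, hi+k]` back to
the nearest-left event at the origin with window `[lo, hi]`. [folklore] -/
theorem nlShift_preimage_relabel_nearestLeft (k lo hi : ℤ) :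
    BondConfig.relabel (sym2Equiv (Site.shift (bpt k))) ⁻¹'
        {ω : BondConfig (Site 2) | ∃ t : ℤ, lo + k ≤ t ∧ t ≤ hi + k ∧
          ω ∈ openConnIn halfPlane (bpt (k)) (bpt t) ∧
            ∀ s : ℤ, t < s → s < k → ω ∉ openConnIn halfPlane (bpt (k)) (bpt s)} =
      {ω : BondConfig (Site 2) | ∃ t : ℤ, lo ≤ t ∧ t ≤ hi ∧
        ω ∈ openConnIn halfPlane (bpt (0)) (bpt t) ∧
          ∀ s : ℤ, t < s → s < 0 → ω ∉ openConnIn halfPlane (bpt (0)) (bpt s)} := by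
  ext ω
  simp only [Set.mem_preimage, Set.mem_setOf_eq]
  constructor
  · rintro ⟨t, hlo, hhi, hconn, hno⟩
    refine ⟨t - k, by omega, by omega, (nlShift_relabel_mem_openConnIn_iff k t ω).1 hconn,
      fun s hts hs0 hs ↦ ?_⟩
    refine hno (s + k) (by omega) (by omega) ((nlShift_relabel_mem_openConnIn_iff k (s + k) ω).2 ?_)
    rwa [add_sub_cancel_right]
  · rintro ⟨t, hlo, hhi, hconn, hno⟩
    refine ⟨t + k, by omega, by omega,
      (nlShift_relabel_mem_openConnIn_iff k (t + k) ω).2 (by rwa [add_sub_cancel_right]),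
      fun s hts hsk hs ↦ ?_⟩
    exact hno (s - k) (by omega) (by omega) ((nlShift_relabel_mem_openConnIn_iff k s ω).1 hs)

/-- STUB Q2 (translation invariance of the nearest-left event): the nearest-left event at `(k,0)`
with window `[lo+k, hi+k]` and the nearest-left event at the origin with window `[lo, hi]` are
lattice translates of one another, hence equiprobable under `P_{1/2}`. [folklore] -/
theorem stub_nearestLeft_shift :
    ∀ (k lo hi : ℤ),
      μ.real {ω : BondConfig (Site 2) | ∃ t : ℤ, lo + k ≤ t ∧ t ≤ hi + k ∧ ω ∈ openConnIn halfPlane (bpt (k)) (bpt t) ∧ ∀ s : ℤ, t < s → s < k → ω ∉ openConnIn halfPlane (bpt (k)) (bpt s)} =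
      μ.real {ω : BondConfig (Site 2) | ∃ t : ℤ, lo ≤ t ∧ t ≤ hi ∧ ω ∈ openConnIn halfPlane (bpt (0)) (bpt t) ∧ ∀ s : ℤ, t < s → s < 0 → ω ∉ openConnIn halfPlane (bpt (0)) (bpt s)} := by
  intro k lo hi
  rw [← nlShift_preimage_relabel_nearestLeft k lo hi]
  unfold μ
  exact (bondPercolation_real_preimage_shift (bpt k) half _).symm

end Positivity

end Summit.CriticalPhenomena.CardyFormulaZ2.Cruxes.HalfPlaneMarkDensityLaw.SketchLine
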